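import Summits.QuantumFields.YangMills.Theses.FibreConvexityTail

/-!
# Route `FibreConvexityTail` (QuantumFields / YangMills; rung-R3 leaf `T3YM3TorusStatement.YM3TorusSU2`) — DEFINITIONS posited by the line of crux
# `TwoSidedTailL` (stmt-QuantumFields-25567): the TWO-SIDED EVENT and the SUB-GAUSSIAN MOMENT INTERFACE between its two registered stubs

Crux `TwoSidedTailL` (the fibre-convexity lever's case of the finest-bad-level tail) is registered with the two-layer plan
`TwoSidedTailL ⇐ stub_fibreMGF → stub_chernoffOnEvent` (BC3 skeleton `TwoSidedTailL_birth.lean`, sha 9234731e…, planner ym-r3-idea-2 g0):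
S1 = a SUB-GAUSSIAN MOMENT-GENERATING-FUNCTION BOUND ON THE TWO-SIDED EVENT (the XL lever: fibre log-concavity + Herbst + the minimiser's mean
bound), S2 = CHERNOFF ON THE EVENT (M).  Both stubs speak about two objects that the route posits and the tree did not have; this file defines
them, and nothing else:

* `twoSidedEvent F γ b₀ p₀ K j a` — the (T)-event of the crux, LITERALLY the set whose Gibbs mass `TwoSidedTailL` bounds: the level-`j` block
  plaquette `a` is `θ(K−j)`-LARGE (`θBal(K−j) ≤ |Ū^{j}(∂a) − 1|`), every finer level `i < j` is Bałaban-small (`PlaqSmall θ(K−i) (Ū^{i})`, the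
  small-field characteristic functions of [Balaban1985UV3] (7) p.257), and the CONDITIONER two levels up is small (`PlaqSmall θ(K−j−2) (Ū^{j+2})`);
* `SubGaussianOnEvent F γ b₀ p₀ K j a M σ` — the interface S1 must deliver and S2 consumes: for every `t ≥ 0` the moment generating function
  (Mathlib's `ProbabilityTheory.mgf`) of the NORMALISED deviation `|Ū^{j}(∂a) − 1| / g_{K−j}` (`g_i = √(γL^{−i})`) under the Gibbs measure RESTRICTED
  to the two-sided event is at most `M·exp(t·p(g_{K−j})/4 + σ²t²/2)` (`p = B10.pFun b₀ p₀`: the Herbst centring `E f ≤ θ/4`, i.e. `p/4` after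
  normalisation, and the sub-Gaussian variance proxy `σ²`).  Chernoff at `t = 3p/(4σ²)` then gives `Gibbs_K(twoSidedEvent) ≤ M·e^{−9p²/(32σ²)}` —
  the per-plaquette schema of the crux with `C = M`, `A = 0`, `c = 9/(32σ²)` (proved in the sibling file `…TwoSidedTailLChernoffOnEvent`).

HONEST SCOPE.  Definitions (and their unfolding / measurability letters) only.  Neither stub, nor the crux, nor the rung R3, nor anything about the
Yang–Mills mass gap is proved here; `YM3TorusSU2` is a RECORD rung of the programme, not the Clay statement.

References: T. Bałaban, CMP 102 (1985) 255–275 [Balaban1985UV3] ((3) p.256, (7) p.257, (71) p.273).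
-/

noncomputable section

open MeasureTheory ProbabilityTheory
open Literature.MathematicalPhysics.QuantumFieldTheory.Balaban1983to89
open Literature.MathematicalPhysics.QuantumFieldTheory.Balaban1983to89.Missing
open Literature.MathematicalPhysics.QuantumFieldTheory.Balaban1983to89.T4Continuum
open Literature.MathematicalPhysics.QuantumFieldTheory.Balaban1983to89.T3ContinuumYM3Torus
open Literature.MathematicalPhysics.QuantumFieldTheory.Balaban1983to89.T3UnitScaleTilt
open Literature.MathematicalPhysics.QuantumFieldTheory.Balaban1983to89.T3UnitLawDensityEML (ℰp measurableE_ℰp)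

namespace Summit.QuantumFields.YangMills.Theorems.FibreConvexityTail

/-! ## §1 The two-sided event -/

/-- **THE TWO-SIDED EVENT** of crux `TwoSidedTailL` for the `K`-th approximation, height `j` and level-`j` plaquette `a`: the block-averaged plaquette
`Ū^{j}(∂a)` is `θ(K−j)`-large, every finer level `i < j` is `θ(K−i)`-small, and the conditioner `Ū^{j+2}` two levels up is `θ(K−j−2)`-small
(thresholds `θBal`, averagings `blockAvg ℰp` iterated).  By construction `TwoSidedTailL` reads
`∀ … a, Gibbs_K(twoSidedEvent F γ b₀ p₀ K j a) ≤ C·β_{K−j}^A·e^{−c·p(g_{K−j})²}` (`twoSidedTailL_iff`).  A definition (an event), asserting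
nothing; the small-field characteristic functions are Bałaban's, CMP 102 (1985) (7) p.257. [folklore] -/
def twoSidedEvent (F : T3Family) (γ b₀ p₀ : ℝ) (K j : ℕ) (a : Plaq (F.P K) j) :
    Set (GaugeField (F.P K) 0 (Matrix.specialUnitaryGroup (Fin 2) ℂ)) :=
  {U | θBal F.L γ b₀ p₀ (K - j) ≤ GaugeGroup.dist1 (GaugeField.plaqHol
      (Averaging.iter (fun i' => BlockAveraging.blockAvg (P := F.P K) (j := i') ℰp) j U) a)} ∩
    {U | ∀ i, i < j → PlaqSmall (θBal F.L γ b₀ p₀ (K - i))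
      (Averaging.iter (fun i' => BlockAveraging.blockAvg (P := F.P K) (j := i') ℰp) i U)} ∩
    {U | PlaqSmall (θBal F.L γ b₀ p₀ (K - (j + 2)))
      (Averaging.iter (fun i' => BlockAveraging.blockAvg (P := F.P K) (j := i') ℰp) (j + 2) U)}

/-- The crux `TwoSidedTailL` is, by `Iff.rfl`, the per-plaquette Gibbs-tail schema for `twoSidedEvent` — recorded so that files proving or
consuming the crux may rewrite between the two spellings. -/
theorem twoSidedTailL_iff :
    Summit.QuantumFields.YangMills.Theses.FibreConvexityTail.TwoSidedTailL ↔
      ∀ (L : ℕ), ∃ bmin : ℝ, ∀ (b₀ p₀ : ℝ), bmin ≤ b₀ → 0 < b₀ → 2 < p₀ → ∃ γ₁ : ℝ, 0 < γ₁ ∧ γ₁ ≤ 1 ∧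
        ∀ (F : T3Family) (γ : ℝ), F.L = L → 0 < γ → γ ≤ γ₁ → ∃ (C : ℝ) (A : ℕ) (c : ℝ), 0 ≤ C ∧ 0 < c ∧
          ∀ (K j : ℕ), 1 ≤ j → j + 2 ≤ K → ∀ (a : Plaq (F.P K) j),
            (gibbsK F ℰp γ K).real (twoSidedEvent F γ b₀ p₀ K j a) ≤
              C * (F.scheme ℰp γ).β (K - j) ^ A *
                Real.exp (-(c * B10.pFun b₀ p₀ (Real.sqrt (γ * ((F.L : ℝ)⁻¹) ^ (K - j))) ^ 2)) :=
  Iff.rfl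

/-- The two-sided event lies inside the single-plaquette tail event `{θ(K−j) ≤ |Ū^{j}(∂a) − 1|}` (its first constituent). -/
theorem twoSidedEvent_subset_tail (F : T3Family) (γ b₀ p₀ : ℝ) (K j : ℕ) (a : Plaq (F.P K) j) :
    twoSidedEvent F γ b₀ p₀ K j a ⊆
      {U | θBal F.L γ b₀ p₀ (K - j) ≤ GaugeGroup.dist1 (GaugeField.plaqHol
        (Averaging.iter (fun i' => BlockAveraging.blockAvg (P := F.P K) (j := i') ℰp) j U) a)} :=
  fun _ hU => hU.1.1

/-- On the two-sided event the conditioner two levels up is small (its third constituent). -/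
theorem plaqSmall_conditioner_of_mem_twoSidedEvent {F : T3Family} {γ b₀ p₀ : ℝ} {K j : ℕ} {a : Plaq (F.P K) j}
    {U : GaugeField (F.P K) 0 (Matrix.specialUnitaryGroup (Fin 2) ℂ)} (hU : U ∈ twoSidedEvent F γ b₀ p₀ K j a) :
    PlaqSmall (θBal F.L γ b₀ p₀ (K - (j + 2)))
      (Averaging.iter (fun i' => BlockAveraging.blockAvg (P := F.P K) (j := i') ℰp) (j + 2) U) :=
  hU.2

/-- `U ↦ |Ū^{j}(∂a) − 1|` is measurable (measurable averagings for the measurable `ℰp`, measurable plaquette variable and `dist1`). -/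
theorem measurable_dist1_plaqHol_iter (F : T3Family) (K j : ℕ) (a : Plaq (F.P K) j) :
    Measurable fun U : GaugeField (F.P K) 0 (Matrix.specialUnitaryGroup (Fin 2) ℂ) =>
      GaugeGroup.dist1 (GaugeField.plaqHol (Averaging.iter (fun i' => BlockAveraging.blockAvg (P := F.P K) (j := i') ℰp) j U) a) :=
  RegularGaugeGroup.measurable_dist1.comp ((Missing.measurable_plaqHol a).comp
    (measurable_iter _ (F.avgMeasurable_of_measurableE ℰp measurableE_ℰp K) j))

/-- The two-sided event is measurable. -/
theorem measurableSet_twoSidedEvent (F : T3Family) (γ b₀ p₀ : ℝ) (K j : ℕ) (a : Plaq (F.P K) j) :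
    MeasurableSet (twoSidedEvent F γ b₀ p₀ K j a) := by
  refine ((measurableSet_le measurable_const (measurable_dist1_plaqHol_iter F K j a)).inter ?_).inter
    (measurable_iter _ (F.avgMeasurable_of_measurableE ℰp measurableE_ℰp K) (j + 2) (measurableSet_plaqSmall _))
  have hset : {U : GaugeField (F.P K) 0 (Matrix.specialUnitaryGroup (Fin 2) ℂ) | ∀ i, i < j →
      PlaqSmall (θBal F.L γ b₀ p₀ (K - i)) (Averaging.iter (fun i' => BlockAveraging.blockAvg (P := F.P K) (j := i') ℰp) i U)} =
      ⋂ i ∈ Finset.range j, {U | PlaqSmall (θBal F.L γ b₀ p₀ (K - i))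
        (Averaging.iter (fun i' => BlockAveraging.blockAvg (P := F.P K) (j := i') ℰp) i U)} := by
    ext U
    simp only [Set.mem_setOf_eq, Set.mem_iInter, Finset.mem_range]
  rw [hset]
  exact MeasurableSet.biInter (Finset.range j).countable_toSet fun i _ =>
    measurable_iter _ (F.avgMeasurable_of_measurableE ℰp measurableE_ℰp K) i (measurableSet_plaqSmall _)

/-! ## §2 The sub-Gaussian moment interface between the two stubs -/

/-- **THE SUB-GAUSSIAN MOMENT BOUND ON THE TWO-SIDED EVENT** (the statement stub `stub_fibreMGF` must deliver and stub `stub_chernoffOnEvent`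
consumes): for every `t ≥ 0`, the moment generating function of the normalised deviation `|Ū^{j}(∂a) − 1| / g_{K−j}` under the Gibbs measure of
the `K`-th approximation RESTRICTED to the two-sided event is at most `M·exp(t·p(g_{K−j})/4 + σ²t²/2)` — centring at a quarter of the threshold
(the constrained minimiser's plaquette plus the mean–mode gap, where `bmin` is spent) and variance proxy `σ²` (Herbst).  A PREDICATE
(hypothesis schema of the line, never asserted here): the standard sub-Gaussian moment condition of concentration of measure, read on an
event. [folklore] -/
def SubGaussianOnEvent (F : T3Family) (γ b₀ p₀ : ℝ) (K j : ℕ) (a : Plaq (F.P K) j) (M σ : ℝ) : Prop :=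
  ∀ t : ℝ, 0 ≤ t →
    mgf (fun U => GaugeGroup.dist1 (GaugeField.plaqHol
          (Averaging.iter (fun i' => BlockAveraging.blockAvg (P := F.P K) (j := i') ℰp) j U) a) /
        Real.sqrt (γ * ((F.L : ℝ)⁻¹) ^ (K - j)))
      ((gibbsK F ℰp γ K).restrict (twoSidedEvent F γ b₀ p₀ K j a)) t ≤
    M * Real.exp (t * (B10.pFun b₀ p₀ (Real.sqrt (γ * ((F.L : ℝ)⁻¹) ^ (K - j))) / 4) + σ ^ 2 * t ^ 2 / 2)

/-- `SubGaussianOnEvent` unfolded to the restricted integral `∫_{twoSidedEvent} exp(t·|Ū^{j}(∂a) − 1|/g_{K−j}) dGibbs_K` (`Iff.rfl`). -/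
theorem subGaussianOnEvent_iff (F : T3Family) (γ b₀ p₀ : ℝ) (K j : ℕ) (a : Plaq (F.P K) j) (M σ : ℝ) :
    SubGaussianOnEvent F γ b₀ p₀ K j a M σ ↔
      ∀ t : ℝ, 0 ≤ t →
        ∫ U in twoSidedEvent F γ b₀ p₀ K j a,
            Real.exp (t * (GaugeGroup.dist1 (GaugeField.plaqHol
              (Averaging.iter (fun i' => BlockAveraging.blockAvg (P := F.P K) (j := i') ℰp) j U) a) /
                Real.sqrt (γ * ((F.L : ℝ)⁻¹) ^ (K - j)))) ∂(gibbsK F ℰp γ K) ≤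
          M * Real.exp (t * (B10.pFun b₀ p₀ (Real.sqrt (γ * ((F.L : ℝ)⁻¹) ^ (K - j))) / 4) + σ ^ 2 * t ^ 2 / 2) :=
  Iff.rfl

end Summit.QuantumFields.YangMills.Theorems.FibreConvexityTail

end
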